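import Mathlib
import Literature.MathematicalPhysics.QuantumFieldTheory.Balaban1983to89.T3ContinuumYM3Torus
import HarnessLib

/-!
# Crux `FluctuationComparisonRegPrIntL` (stmt-QuantumFields-20520), LINE «run-pair organ» (ym-r3-idea-1 g14) —
registered stub `stub_integralOfTV` (S)

Integral form of total variation: if two probability measures `μ, μ'` on the same space satisfy
`|μ.real A − μ'.real A| ≤ ε` for every measurable set `A`, then for every measurable `f` with `|f| ≤ 1`,
`|∫ f dμ − ∫ f dμ'| ≤ 2ε`.

Proof (layer cake): for `g := f + 1 ∈ [0, 2]`, `∫ g dν = ∫_{t ∈ (0,2]} ν.real {g ≥ t} dt`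
(`Integrable.integral_eq_integral_Ioc_meas_le`); the two `t`-integrands differ by at most `ε` pointwise on a set of
Lebesgue measure `2`, whence the bound (`norm_setIntegral_le_of_norm_le_const`).

This is the statement of the registered stub `stub_integralOfTV` of the skeleton
`Summits/QuantumFields/YangMills/Cruxes/FluctuationComparisonRegPrIntL/Lines/runpair_organ.lean` (the general form
`abs_integral_sub_integral_le_two_mul` first, then the specialisation to unit-lattice gauge fields).  Pure measure
theory; no summit, rung, organ or crux is proved by this file; `YM3TorusSU2` and the Yang–Mills mass gap are NOT proved.
-/

set_option autoImplicit false

open MeasureTheory Set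

namespace Summit.QuantumFields.YangMills.Theorems.FluctuationComparisonRegPrIntL.RunPairOrgan

/-- General form: set-wise `ε`-closeness of two probability measures bounds the difference of the integrals of a
measurable function with `|f| ≤ 1` by `2ε`. -/
theorem abs_integral_sub_integral_le_two_mul {α : Type*} [MeasurableSpace α]
    (μ μ' : Measure α) [IsProbabilityMeasure μ] [IsProbabilityMeasure μ'] (ε : ℝ)
    (hA : ∀ A : Set α, MeasurableSet A → |μ.real A - μ'.real A| ≤ ε)
    (f : α → ℝ) (hf : Measurable f) (hb : ∀ u, |f u| ≤ 1) :
    |(∫ u, f u ∂μ) - (∫ u, f u ∂μ')| ≤ 2 * ε := by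
  have hg_meas : Measurable fun u => f u + 1 := hf.add_const 1
  have hg_nn : ∀ u, 0 ≤ f u + 1 := fun u => by have := (abs_le.mp (hb u)).1; linarith
  have hg_le : ∀ u, f u + 1 ≤ 2 := fun u => by have := (abs_le.mp (hb u)).2; linarith
  have hfi : ∀ (ν : Measure α) [IsProbabilityMeasure ν], Integrable f ν := fun ν _ =>
    (integrable_const (1 : ℝ)).mono' hf.aestronglyMeasurable
      (Filter.Eventually.of_forall fun u => by rw [Real.norm_eq_abs]; exact hb u)
  have hgi : ∀ (ν : Measure α) [IsProbabilityMeasure ν], Integrable (fun u => f u + 1) ν := fun ν _ =>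
    (hfi ν).add (integrable_const 1)
  have key : ∀ (ν : Measure α) [IsProbabilityMeasure ν],
      ∫ u, f u ∂ν = (∫ t in Ioc (0 : ℝ) 2, ν.real {a | t ≤ f a + 1}) - 1 := by
    intro ν _
    have h1 : ∫ u, (f u + 1) ∂ν = ∫ t in Ioc (0 : ℝ) 2, ν.real {a | t ≤ f a + 1} :=
      (hgi ν).integral_eq_integral_Ioc_meas_le (Filter.Eventually.of_forall hg_nn)
        (Filter.Eventually.of_forall hg_le)
    have h2 : ∫ u, (f u + 1) ∂ν = (∫ u, f u ∂ν) + 1 := by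
      rw [integral_add (hfi ν) (integrable_const 1)]
      simp
    linarith
  have hI : ∀ (ν : Measure α) [IsProbabilityMeasure ν],
      IntegrableOn (fun t : ℝ => ν.real {a | t ≤ f a + 1}) (Ioc (0 : ℝ) 2) volume := by
    intro ν _
    have hanti : Antitone fun t : ℝ => ν.real {a | t ≤ f a + 1} := by
      intro s t hst
      exact measureReal_mono (fun a (ha : t ≤ f a + 1) => le_trans hst ha)
    have hc : IntegrableOn (fun _ : ℝ => (1 : ℝ)) (Ioc (0 : ℝ) 2) volume := integrable_const _
    refine hc.mono' hanti.measurable.aestronglyMeasurable (Filter.Eventually.of_forall fun t => ?_)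
    rw [Real.norm_eq_abs, abs_of_nonneg measureReal_nonneg]
    calc ν.real {a | t ≤ f a + 1} ≤ ν.real univ := measureReal_mono (subset_univ _)
      _ = 1 := probReal_univ
  rw [key μ, key μ']
  have hsub : ((∫ t in Ioc (0 : ℝ) 2, μ.real {a | t ≤ f a + 1}) - 1) -
      ((∫ t in Ioc (0 : ℝ) 2, μ'.real {a | t ≤ f a + 1}) - 1) =
      ∫ t in Ioc (0 : ℝ) 2, (μ.real {a | t ≤ f a + 1} - μ'.real {a | t ≤ f a + 1}) := by
    rw [integral_sub (hI μ) (hI μ')]; ring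
  rw [hsub]
  have hvol : volume.real (Ioc (0 : ℝ) 2) = 2 := by
    rw [Real.volume_real_Ioc_of_le (by norm_num)]; norm_num
  have hset : ∀ t : ℝ, MeasurableSet {a | t ≤ f a + 1} := fun t =>
    measurableSet_le measurable_const hg_meas
  have hn := norm_setIntegral_le_of_norm_le_const (μ := volume) (s := Ioc (0 : ℝ) 2)
    (f := fun t : ℝ => μ.real {a | t ≤ f a + 1} - μ'.real {a | t ≤ f a + 1}) (C := ε)
    measure_Ioc_lt_top (fun t _ => by rw [Real.norm_eq_abs]; exact hA _ (hset t))
  rw [Real.norm_eq_abs, hvol] at hn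
  linarith

open Literature.MathematicalPhysics.QuantumFieldTheory.Balaban1983to89 T3ContinuumYM3Torus

/-- The skeleton's Prop `IntegralOfTV` (verbatim copy of
`Summit.QuantumFields.YangMills.Cruxes.FluctuationComparisonRegPrIntL.RunPairOrgan.IntegralOfTV`, to which it is
definitionally equal): the integral form of total variation for two probability laws on unit-lattice `SU(2)` gauge
fields at height `j`. -/
def IntegralOfTV : Prop :=
  ∀ (F : T3Family) (j : ℕ) (μ μ' : MeasureTheory.Measure (GaugeField (F.P j) 0 ↥(Matrix.specialUnitaryGroup (Fin 2) ℂ))),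
    IsProbabilityMeasure μ → IsProbabilityMeasure μ' → ∀ ε : ℝ, 0 ≤ ε →
    (∀ A : Set (GaugeField (F.P j) 0 ↥(Matrix.specialUnitaryGroup (Fin 2) ℂ)), MeasurableSet A → |μ.real A - μ'.real A| ≤ ε) →
    ∀ f : GaugeField (F.P j) 0 ↥(Matrix.specialUnitaryGroup (Fin 2) ℂ) → ℝ, Measurable f → (∀ u, |f u| ≤ 1) →
      |(∫ u, f u ∂μ) - (∫ u, f u ∂μ')| ≤ 2 * ε

/-- Registered stub `stub_integralOfTV` of LINE «run-pair organ» (header verbatim = the skeleton's). -/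
theorem stub_integralOfTV : IntegralOfTV := by
  intro F j μ μ' hμ hμ' ε _hε hA f hf hb
  exact abs_integral_sub_integral_le_two_mul μ μ' ε hA f hf hb

end Summit.QuantumFields.YangMills.Theorems.FluctuationComparisonRegPrIntL.RunPairOrgan
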